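import Summits.CriticalPhenomena.SAWScalingLimit.Theorems.SAWDefectDecoherenceBoundaryClosureRGateDbarTwisted
import Summits.CriticalPhenomena.SAWScalingLimit.Theorems.SAWDefectDecoherenceBoundaryClosureRGateDbarBoundary
import Summits.CriticalPhenomena.SAWScalingLimit.Theorems.SAWDefectDecoherenceBoundaryClosureRGateDbarRemainder
import Summits.CriticalPhenomena.SAWScalingLimit.Theorems.SAWDefectDecoherenceBoundaryClosureRPickEngineWeakDbar
import Summits.CriticalPhenomena.SAWScalingLimit.Theorems.SAWDefectDecoherenceBoundaryClosureRDressedArrival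
import Literature.Analysis.Complex.DbarBumpResidue
import HarnessLib

/-!
# Gate `∂̄`-limit, V: `N_δ(∂̄φ) → −i√3 ∫_gate φ e^{(5/8)(L̄ − L_b)} dx` (registered stub `stub_gateDbarLimit`)
(crux `BoundaryClosureR`, stmt-CriticalPhenomena-14004, line `polygon-parity-squeeze`, mechanism (C))

THE lattice → continuum limit behind the gate trace: for an admissible family pinned at the root
with `2ρ < |pt 0 − pt 1|`, `DefectDecoherence`, the gate profile law and the gate layer budget on
`B(pt 1, ρ/4)`, every frame with a continuous gate extension `L̄`, and every smooth `φ` supported in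
`B(pt 1, ρ/4)`:  `N_δ(∂̄φ) → −i√3 · ∫ φ(x + i·im pt 1) exp((5/8)(L̄(x + i·im pt 1) − L_b)) dx`.
With the landed `gateTrace_of_gateDbarLimit` (`…GateTraceOfGateData.lean`) this gives `stub_gateTrace`.

PROOF (assembled here from files I–IV).  At one mesh, DCS Lemma 1 summed against `φ(δ c_v)` and
Taylor-expanded at the mid-edges (`HexObservableLimitR.greenLimit_identity`) reads
`N_δ(∂̄φ) = 6δ·(gate dart sum) − (twisted term) − 6·(Taylor remainder) + δ²·(boundary part of N_δ)`
(`GateDbar.finsum_midEdges_split`).  The gate dart sum is `−i√3 ·` the φ-tested gate profile sum up to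
`O(δ)` (`GateDbar.boundary_term_at`: flat pinned floor, one phase, `mid − c_v = −i/(2√3)`), and the
profile sum converges to the stated integral by `GateProfileAt`; the twisted term is
`O(δ^{min(θ−3/4,1/2)}) + O(δ^{1/4})` by `DefectDecoherence` at depth `(k+1)/2` on row `k` plus the layer
budget (`GateDbar.twisted_norm_le_at`, `GateDbar.delta_mul_sum_decay_le`); the remainder is
`O(δ^{1/4})` by the layer budget alone (`GateDbar.remainder_indicator_le`, `GateDbar.layerCake_le`);
the boundary part of `N_δ` and the `O(δ)` error of the dart sum are controlled by the profile law
tested against a bump (`GateDbar.norm_boundary_finsum_le`, `GateDbar.norm_bumpSum_eq`).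
References: Duminil-Copin–Smirnov, Ann. of Math. 175 (2012), §3 and Conjecture 2.
-/

noncomputable section

open scoped BigOperators Topology Classical ComplexConjugate ContDiff
open Filter Set Metric Complex MeasureTheory
open Literature.Probability.LatticeModels Literature.Probability.RandomPlanarGeometry
open Literature.Probability.RandomPlanarGeometry.SAW
open Literature.Barriers.CriticalPhenomena.HexGreen (nbrs mem_nbrs_iff satisfiesVertexRelations_iff_sum)
open Literature.Analysis.Complex (dbarAlong dbarAlong_one dbarAlong_eq_zero_of_notMem_tsupport
  hasCompactSupport_dbarAlong_one)
open Summit.CriticalPhenomena.SAWScalingLimit.Theses.SAWDefectDecoherence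
open Summit.CriticalPhenomena.SAWScalingLimit.Theorems.PickHalfPlane
open Summit.CriticalPhenomena.SAWScalingLimit.Theorems.HexObservableLimitR (greenLimit_identity
  greenLimit_remainder_norm_le greenLimit_taylor_symm)

namespace Summit.CriticalPhenomena.SAWScalingLimit.Theorems.PolygonParitySqueeze.GateDbar

/-! ### 1. Small analytic facts -/

/-- `∂̄φ = (φ_x + iφ_y)/2` written with a division. [folklore] -/
theorem dbarAlong_one_eq_div (φ : ℂ → ℂ) (z : ℂ) :
    dbarAlong 1 φ z = (fderiv ℝ φ z 1 + I * fderiv ℝ φ z I) / 2 := by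
  rw [dbarAlong_one, smul_eq_mul, smul_eq_mul]; ring

/-- `∂φ = (φ_x − iφ_y)/2` of a smooth function is `C¹`. [folklore] -/
theorem contDiff_dAlong_div {φ : ℂ → ℂ} (hφ : ContDiff ℝ ∞ φ) :
    ContDiff ℝ 1 fun z => (fderiv ℝ φ z 1 - I * fderiv ℝ φ z I) / 2 := by
  have h := Engine.contDiff_one_dAlong hφ
  have e : (fun z => (fderiv ℝ φ z 1 - I * fderiv ℝ φ z I) / 2) =
      fun z => (2 : ℂ)⁻¹ * (fderiv ℝ φ z 1 - I * fderiv ℝ φ z I) := by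
    ext z; rw [div_eq_inv_mul]
  rw [e]; exact h

/-- `∂φ` vanishes off `supp φ`. [folklore] -/
theorem dAlong_eq_zero_of_notMem {φ : ℂ → ℂ} {z : ℂ} (hz : z ∉ tsupport φ) :
    (fderiv ℝ φ z 1 - I * fderiv ℝ φ z I) / 2 = 0 := by
  have hfd : fderiv ℝ φ z = 0 := by
    by_contra hne; exact hz (support_fderiv_subset ℝ (Function.mem_support.2 hne))
  simp [hfd]

/-- The majorant `A δ^s + B δ^{1/4} + C δ → 0` as `δ → 0⁺` (`0 < s`). [folklore] -/
theorem tendsto_majorant (A B C : ℝ) {s : ℝ} (hs : 0 < s) :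
    Tendsto (fun δ : ℝ => A * δ ^ s + B * δ ^ (1 / 4 : ℝ) + C * δ) (𝓝[>] 0) (𝓝 0) := by
  have h1 : Tendsto (fun δ : ℝ => δ ^ s) (𝓝 (0 : ℝ)) (𝓝 0) := by
    have := (Real.continuousAt_rpow_const 0 s (Or.inr hs.le)).tendsto
    simpa [Real.zero_rpow hs.ne'] using this
  have h2 : Tendsto (fun δ : ℝ => δ ^ (1 / 4 : ℝ)) (𝓝 (0 : ℝ)) (𝓝 0) := by
    have := (Real.continuousAt_rpow_const 0 (1 / 4 : ℝ) (Or.inr (by norm_num))).tendsto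
    simpa [Real.zero_rpow (show (1 / 4 : ℝ) ≠ 0 by norm_num)] using this
  have h3 : Tendsto (fun δ : ℝ => δ) (𝓝 (0 : ℝ)) (𝓝 0) := tendsto_id
  have := ((h1.const_mul A).add (h2.const_mul B)).add (h3.const_mul C)
  simp only [mul_zero, add_zero] at this
  exact this.mono_left nhdsWithin_le_nhds

/-- **The power sums of the twisted bound.** For `0 < δ ≤ ρ`, `K ≤ ρ/δ`, `0 < s < 1`, `3/4 − θ ≤ −s`
and nonnegative constants: `6 C_B δ Σ_{k ≤ K} (Mψ A₀ (k+1)^{-θ} + Lψ δ/4)(k+1)^{3/4} ≤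
6 C_B (Mψ A₀ (2ρ)^{1-s}/(1-s) δ^s + (Lψ/4)(2ρ)^{7/4} δ^{1/4})`. [folklore] -/
theorem twisted_sum_le {δ ρ θ s CB Mψ A₀ Lψ : ℝ} {K : ℕ} (hδ : 0 < δ) (hδρ : δ ≤ ρ) (hK : (K : ℝ) ≤ ρ / δ)
    (hs0 : 0 < s) (hs1 : s < 1) (hsθ : -θ + 3 / 4 ≤ -s) (hCB : 0 ≤ CB) (hMψ : 0 ≤ Mψ) (hA₀ : 0 ≤ A₀)
    (hLψ : 0 ≤ Lψ) :
    6 * CB * δ * ∑ k ∈ Finset.range (K + 1),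
        (Mψ * A₀ * ((k : ℝ) + 1) ^ (-θ) + Lψ * δ / 4) * ((k : ℝ) + 1) ^ (3 / 4 : ℝ) ≤
      6 * CB * (Mψ * A₀ * ((2 * ρ) ^ (1 - s) / (1 - s)) * δ ^ s + Lψ / 4 * ((2 * ρ) ^ (7 / 4 : ℝ) * δ ^ (1 / 4 : ℝ))) := by
  have hdec := delta_mul_sum_decay_le hδ hδρ hK hs0.le hs1
  have hgro := delta_sq_mul_sum_growth_le hδ hδρ hK
  -- termwise: `(k+1)^{-θ}(k+1)^{3/4} ≤ (k+1)^{-s}`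
  have hterm : ∀ k : ℕ, ((k : ℝ) + 1) ^ (-θ) * ((k : ℝ) + 1) ^ (3 / 4 : ℝ) ≤ ((k : ℝ) + 1) ^ (-s) := by
    intro k
    have hk1 : (1 : ℝ) ≤ (k : ℝ) + 1 := by have : (0:ℝ) ≤ k := Nat.cast_nonneg k; linarith
    rw [← Real.rpow_add (by linarith)]
    exact Real.rpow_le_rpow_of_exponent_le hk1 hsθ
  have hsplit : ∑ k ∈ Finset.range (K + 1),
      (Mψ * A₀ * ((k : ℝ) + 1) ^ (-θ) + Lψ * δ / 4) * ((k : ℝ) + 1) ^ (3 / 4 : ℝ) ≤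
      Mψ * A₀ * ∑ k ∈ Finset.range (K + 1), ((k : ℝ) + 1) ^ (-s) +
        Lψ * δ / 4 * ∑ k ∈ Finset.range (K + 1), ((k : ℝ) + 1) ^ (3 / 4 : ℝ) := by
    rw [Finset.mul_sum, Finset.mul_sum, ← Finset.sum_add_distrib]
    refine Finset.sum_le_sum fun k _ => ?_
    have h1 := hterm k
    have h2 : 0 ≤ ((k : ℝ) + 1) ^ (3 / 4 : ℝ) := Real.rpow_nonneg (by positivity) _
    have hMA : 0 ≤ Mψ * A₀ := mul_nonneg hMψ hA₀
    nlinarith [mul_le_mul_of_nonneg_left h1 hMA]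
  have hδ0 := hδ.le
  calc 6 * CB * δ * ∑ k ∈ Finset.range (K + 1),
        (Mψ * A₀ * ((k : ℝ) + 1) ^ (-θ) + Lψ * δ / 4) * ((k : ℝ) + 1) ^ (3 / 4 : ℝ)
      ≤ 6 * CB * δ * (Mψ * A₀ * ∑ k ∈ Finset.range (K + 1), ((k : ℝ) + 1) ^ (-s) +
          Lψ * δ / 4 * ∑ k ∈ Finset.range (K + 1), ((k : ℝ) + 1) ^ (3 / 4 : ℝ)) :=
        mul_le_mul_of_nonneg_left hsplit (by positivity)
    _ = 6 * CB * (Mψ * A₀ * (δ * ∑ k ∈ Finset.range (K + 1), ((k : ℝ) + 1) ^ (-s)) +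
          Lψ / 4 * (δ ^ 2 * ∑ k ∈ Finset.range (K + 1), ((k : ℝ) + 1) ^ (3 / 4 : ℝ))) := by ring
    _ ≤ 6 * CB * (Mψ * A₀ * ((2 * ρ) ^ (1 - s) / (1 - s) * δ ^ s) +
          Lψ / 4 * ((2 * ρ) ^ (7 / 4 : ℝ) * δ ^ (1 / 4 : ℝ))) := by gcongr
    _ = _ := by ring

/-! ### 2. The limit -/

set_option maxHeartbeats 400000 in
/-- **`GateDbarLimit`.** For an admissible family pinned at the root with `2ρ < |pt 0 − pt 1|`,
`DefectDecoherence`, the gate profile law and the gate layer budget on `B(pt 1, ρ/4)`, every conformal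
frame with a continuous gate extension `L̄` and every smooth `φ` compactly supported in
`B(pt 1, ρ/4)`: `N_δ(∂̄φ) → −i√3 ∫_{re pt 1 − ρ/4}^{re pt 1 + ρ/4} φ(x + i im pt 1) e^{(5/8)(L̄ − L_b)} dx`.
[cite: DuminilCopinSmirnov2012, Conjecture 2 (boundary shadow on the gate)] -/
theorem gateDbarLimit_of {D : DobrushinDomain} {ρ : ℝ} {Λ : ℝ → Finset HexVertex} {m : ℝ → ℤ}
    {b : ℝ → Sym2 HexVertex} (hAF : AdmissibleFamily D ρ Λ m b) {a : ℝ → Sym2 HexVertex} {r₀ : ℝ}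
    {m₀ : ℝ → ℤ} (hPR : PinnedFlatRoot D Λ b (D.pt 0) a r₀ m₀) (hρd : 2 * ρ < dist (D.pt 0) (D.pt 1))
    (hDD : DefectDecoherence) (hGP : GateProfileAt D ρ (ρ / 4) Λ a b)
    (hGB : GateLayerBudgetAt D (ρ / 4) Λ m a b)
    {Φ : ConformalEquiv D.carrier UpperHalfPlane.upperHalfPlaneSet} {L : ℂ → ℂ} {Lb : ℂ}
    (hfr : ConformalFrame D Φ L Lb) {Lbar : ℂ → ℂ} (hLbar : ContinuousOn Lbar (D.carrier ∪ gateSeg D ρ))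
    (hLbarL : EqOn Lbar L D.carrier) {φ : ℂ → ℂ} (hφ : ContDiff ℝ ∞ φ) (hφc : HasCompactSupport φ)
    (hφs : tsupport φ ⊆ ball (D.pt 1) (ρ / 4)) :
    Tendsto (fun δ : ℝ => NF Λ a b δ (dbarAlong 1 φ)) (𝓝[>] 0)
      (𝓝 (-(I * (Real.sqrt 3 : ℂ)) * ∫ x in Set.Ioo ((D.pt 1).re - ρ / 4) ((D.pt 1).re + ρ / 4),
        φ ((x : ℂ) + ((D.pt 1).im : ℂ) * I) *
          Complex.exp ((5 / 8 : ℂ) * (Lbar ((x : ℂ) + ((D.pt 1).im : ℂ) * I) - Lb)))) := by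
  obtain ⟨hρ, hflat, hadm, -, hbt⟩ := hAF
  obtain ⟨-, -, hroot, hat⟩ := hPR
  set c : ℂ := D.pt 1 with hc
  ---------------------------------------------------------------- the tested profile sum and its limit
  set X : ℝ → ℂ := fun δ => (δ : ℂ) *
    ∑ᶠ e ∈ {e : Sym2 HexVertex | e ∈ hexDomainBoundary (Λ δ) ∧ (δ : ℂ) * hexMidpoint e ∈ ball c (ρ / 4)},
      φ ((δ : ℂ) * hexMidpoint e) *
        (hexParafermionicObservable (Λ δ) (a δ) hexCriticalFugacity 0 e /
          hexParafermionicObservable (Λ δ) (a δ) hexCriticalFugacity 0 (b δ)) with hXdef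
  have hX : Tendsto X (𝓝[>] 0) (𝓝 (∫ x in Set.Ioo ((D.pt 1).re - ρ / 4) ((D.pt 1).re + ρ / 4),
      φ ((x : ℂ) + ((D.pt 1).im : ℂ) * I) *
        Complex.exp ((5 / 8 : ℂ) * (Lbar ((x : ℂ) + ((D.pt 1).im : ℂ) * I) - Lb)))) :=
    hGP Φ L Lb hfr Lbar hLbar hLbarL φ hφ.continuous hφc hφs
  suffices hdiff : Tendsto (fun δ : ℝ => NF Λ a b δ (dbarAlong 1 φ) - -(I * (Real.sqrt 3 : ℂ)) * X δ)
      (𝓝[>] 0) (𝓝 0) by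
    have := hdiff.add (hX.const_mul (-(I * (Real.sqrt 3 : ℂ))))
    simpa using this
  ---------------------------------------------------------------- radii and the bump
  obtain ⟨ρ₁, hρ₁, hφρ₁⟩ := exists_lt_subset_ball (isClosed_tsupport φ) hφs
  set ρφ : ℝ := max ρ₁ 0 with hρφdef
  have hρφ0 : 0 ≤ ρφ := le_max_right _ _
  have hρφ4 : ρφ < ρ / 4 := max_lt hρ₁ (by positivity)
  have hφρφ : tsupport φ ⊆ ball c ρφ := hφρ₁.trans (ball_subset_ball (le_max_left _ _))
  set η : ℝ := ρ / 4 - ρφ with hηdef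
  have hη : 0 < η := by rw [hηdef]; linarith
  let βb : ContDiffBump c := ⟨ρφ + η / 2, ρφ + 3 * η / 4, by positivity, by linarith⟩
  set β : ℂ → ℝ := fun z => βb z with hβdef
  have hβ0 : ∀ z, 0 ≤ β z := fun z => βb.nonneg
  have hβ1 : ∀ z ∈ closedBall c (ρφ + η / 2), β z = 1 := fun z hz => βb.one_of_mem_closedBall hz
  have hβs : ∀ z, β z ≠ 0 → z ∈ ball c (ρ / 4) := fun z hz => by
    have : z ∈ Function.support (βb : ℂ → ℝ) := hz
    rw [βb.support_eq] at this
    exact ball_subset_ball (by show ρφ + 3 * η / 4 ≤ ρ / 4; rw [hηdef]; linarith) this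
  set g₀ : ℂ → ℂ := fun z => ((β z : ℝ) : ℂ) with hg₀def
  have hg₀c : Continuous g₀ := continuous_ofReal.comp βb.continuous
  have hg₀s : HasCompactSupport g₀ := βb.hasCompactSupport.comp_left Complex.ofReal_zero
  have hg₀t : tsupport g₀ ⊆ ball c (ρ / 4) := by
    refine (tsupport_comp_subset Complex.ofReal_zero _).trans ?_
    rw [βb.tsupport_eq]
    exact closedBall_subset_ball (by show ρφ + 3 * η / 4 < ρ / 4; rw [hηdef]; linarith)
  obtain ⟨ℓ, hℓ⟩ : ∃ ℓ : ℂ, Tendsto (fun δ : ℝ => (δ : ℂ) *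
      ∑ᶠ e ∈ {e : Sym2 HexVertex | e ∈ hexDomainBoundary (Λ δ) ∧ (δ : ℂ) * hexMidpoint e ∈ ball c (ρ / 4)},
        g₀ ((δ : ℂ) * hexMidpoint e) *
          (hexParafermionicObservable (Λ δ) (a δ) hexCriticalFugacity 0 e /
            hexParafermionicObservable (Λ δ) (a δ) hexCriticalFugacity 0 (b δ))) (𝓝[>] 0) (𝓝 ℓ) :=
    ⟨_, hGP Φ L Lb hfr Lbar hLbar hLbarL g₀ hg₀c hg₀s hg₀t⟩
  have hbdd := (hℓ.norm).eventually (gt_mem_nhds (lt_add_one ‖ℓ‖))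
  ---------------------------------------------------------------- analytic constants
  have hφ3 : ContDiff ℝ 3 φ := hφ.of_le (by
    change ((3 : ℕ∞) : WithTop ℕ∞) ≤ ((⊤ : ℕ∞) : WithTop ℕ∞); exact WithTop.coe_le_coe.2 le_top)
  have hφ1 : ContDiff ℝ 1 φ := hφ.of_le (by
    change ((1 : ℕ∞) : WithTop ℕ∞) ≤ ((⊤ : ℕ∞) : WithTop ℕ∞); exact WithTop.coe_le_coe.2 le_top)
  obtain ⟨M, hM0, hM⟩ := greenLimit_taylor_symm hφ3 hφc
  obtain ⟨Kφ, hKφ⟩ := hφ1.lipschitzWith_of_hasCompactSupport hφc one_ne_zero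
  have hφL : ∀ x y, ‖φ x - φ y‖ ≤ (Kφ : ℝ) * ‖x - y‖ := fun x y => by
    rw [← dist_eq_norm, ← dist_eq_norm]; exact hKφ.dist_le_mul x y
  have hφsupp : ∀ z, φ z ≠ 0 → z ∈ ball c ρφ := fun z hz =>
    hφρφ (subset_tsupport _ (Function.mem_support.2 hz))
  -- `∂φ`
  set ψ₂ : ℂ → ℂ := fun z => (fderiv ℝ φ z 1 - I * fderiv ℝ φ z I) / 2 with hψ₂def
  have hψ₂d : ContDiff ℝ 1 ψ₂ := contDiff_dAlong_div hφ
  have hψ₂K : ∀ z, z ∉ tsupport φ → ψ₂ z = 0 := fun z hz => dAlong_eq_zero_of_notMem hz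
  have hψ₂c : HasCompactSupport ψ₂ := HasCompactSupport.intro hφc hψ₂K
  have hψ₂s : ∀ z, ψ₂ z ≠ 0 → z ∈ ball c ρφ := fun z hz => hφρφ (by by_contra h; exact hz (hψ₂K z h))
  obtain ⟨Mψ, hMψ⟩ := hψ₂d.continuous.bounded_above_of_compact_support hψ₂c
  obtain ⟨Kψ, hKψ⟩ := hψ₂d.lipschitzWith_of_hasCompactSupport hψ₂c one_ne_zero
  have hψL : ∀ x y, ‖ψ₂ x - ψ₂ y‖ ≤ (Kψ : ℝ) * ‖x - y‖ := fun x y => by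
    rw [← dist_eq_norm, ← dist_eq_norm]; exact hKψ.dist_le_mul x y
  have hMψ0 : 0 ≤ Mψ := (norm_nonneg _).trans (hMψ 0)
  -- `∂̄φ`
  have hψ₁s : ∀ z, dbarAlong 1 φ z ≠ 0 → z ∈ tsupport φ := fun z hz => by
    by_contra h; exact hz (dbarAlong_eq_zero_of_notMem_tsupport h)
  obtain ⟨M₁, hM₁⟩ := (Engine.continuous_dbarAlong_one hφ).bounded_above_of_compact_support
    (hasCompactSupport_dbarAlong_one hφc)
  have hM₁0 : 0 ≤ M₁ := (norm_nonneg _).trans (hM₁ 0)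
  ---------------------------------------------------------------- route constants
  obtain ⟨C, θ, hθ, hDDall⟩ := hDD
  obtain ⟨CB, hGBev⟩ := hGB
  set CB' : ℝ := max CB 0 with hCB'
  have hCB'0 : 0 ≤ CB' := le_max_right _ _
  set s : ℝ := min (θ - 3 / 4) (1 / 2) with hsdef
  have hs0 : 0 < s := lt_min (by linarith) (by norm_num)
  have hs1 : s < 1 := (min_le_right _ _).trans_lt (by norm_num)
  have hsθ : -θ + 3 / 4 ≤ -s := by have := min_le_left (θ - 3 / 4) (1 / 2); rw [hsdef]; linarith
  set A₀ : ℝ := max (1 / 2) (C * 2 ^ θ) with hA₀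
  have hA₀0 : 0 ≤ A₀ := le_max_of_le_left (by norm_num)
  ---------------------------------------------------------------- the majorant
  set gA : ℝ := 6 * CB' * (Mψ * A₀ * ((2 * ρ) ^ (1 - s) / (1 - s))) with hgA
  set gB : ℝ := 6 * CB' * ((Kψ : ℝ) / 4 * (2 * ρ) ^ (7 / 4 : ℝ)) + 6 * (M / 8 * (CB' * (2 * ρ) ^ (7 / 4 : ℝ)))
    with hgB
  set gC : ℝ := Real.sqrt 3 * ((Kφ : ℝ) / 2) * (‖ℓ‖ + 1) + M₁ * (‖ℓ‖ + 1) with hgC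
  refine squeeze_zero_norm' ?_ (tendsto_majorant gA gB gC hs0)
  ---------------------------------------------------------------- eventual lattice facts
  have hpinev : ∀ᶠ δ : ℝ in 𝓝[>] 0, ∀ v : HexVertex,
      (δ : ℂ) * hexCenter v ∈ ball c ρ → (v ∈ Λ δ ↔ m δ ≤ v.1 1) := hadm.mono fun δ h => h.2.2.2.2
  have hbev : ∀ᶠ δ : ℝ in 𝓝[>] 0, b δ ∈ hexDomainBoundary (Λ δ) := hadm.mono fun δ h => h.2.1
  have hfloor : ∀ᶠ δ : ℝ in 𝓝[>] 0, |δ * (m δ : ℝ) * (Real.sqrt 3 / 2) - c.im| < ρ / 4 := by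
    have h := Metric.tendsto_nhds.1 (GateMass.tendsto_floorHeight hρ hpinev hbev hbt) (ρ / 4) (by positivity)
    exact h.mono fun δ hδ => by rwa [Real.dist_eq] at hδ
  have hbfloor := GateMass.eventually_exists_eq_floorEdge hρ hpinev hbev hbt
  have hbnear : ∀ᶠ δ : ℝ in 𝓝[>] 0, (δ : ℂ) * hexMidpoint (b δ) ∈ ball c (ρ / 4) :=
    hbt (ball_mem_nhds c (by positivity))
  have hafar : ∀ᶠ δ : ℝ in 𝓝[>] 0, ρ ≤ dist ((δ : ℂ) * hexMidpoint (a δ)) c := by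
    have h : ∀ᶠ δ : ℝ in 𝓝[>] 0, (δ : ℂ) * hexMidpoint (a δ) ∈ ball (D.pt 0) ρ := hat (ball_mem_nhds _ hρ)
    refine h.mono fun δ hδ => ?_
    have := dist_triangle (D.pt 0) ((δ : ℂ) * hexMidpoint (a δ)) c
    rw [mem_ball, dist_comm] at hδ
    linarith
  have hnormev := LocalL1.eventually_normaliser_ne_zero_of_bundles hadm hroot
  have hsmall : ∀ᶠ δ : ℝ in 𝓝[>] 0, δ < min (η / 2) (ρ / 8) := by
    have : Iio (min (η / 2) (ρ / 8)) ∈ 𝓝 (0 : ℝ) := Iio_mem_nhds (lt_min (by positivity) (by positivity))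
    exact mem_nhdsWithin_of_mem_nhds this
  filter_upwards [self_mem_nhdsWithin, hsmall, hadm, hroot, hnormev, hGBev, hfloor, hbfloor, hbnear, hafar, hbdd]
    with δ hδ0 hδs hadmδ hrootδ hnormδ hGBδ hfloorδ hbfloorδ hbnearδ hafarδ hbddδ
  have hδ : 0 < δ := hδ0
  have hδη : δ < η / 2 := lt_of_lt_of_le hδs (min_le_left _ _)
  have hδρ8 : δ < ρ / 8 := lt_of_lt_of_le hδs (min_le_right _ _)
  obtain ⟨hsc, -, -, -, hpin⟩ := hadmδ
  obtain ⟨habd, -, -⟩ := hrootδ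
  obtain ⟨kb, hkb⟩ := hbfloorδ
  obtain ⟨haE, u, w, hauw, hw, hu⟩ := habd
  have huw : hexGraph.Adj u w := by rw [hauw] at haE; exact (SimpleGraph.mem_edgeSet hexGraph).1 haE
  have habd' : s(u, w) ∈ hexDomainBoundary (Λ δ) := ⟨by rw [← hauw]; exact haE, u, w, rfl, hw, hu⟩
  -- rewrite the root and the normaliser
  simp only [NF, hXdef]
  rw [hkb] at hnormδ hGBδ hbnearδ hbddδ
  rw [hauw] at hnormδ hGBδ hafarδ hbddδ
  rw [hauw, hkb]
  set Λδ := Λ δ with hΛδ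
  set F : Sym2 HexVertex → ℂ := hexParafermionicObservable Λδ s(u, w) hexCriticalFugacity (5 / 8) with hFdef
  set Z : Sym2 HexVertex → ℂ := hexParafermionicObservable Λδ s(u, w) hexCriticalFugacity 0 with hZdef
  set ekb : Sym2 HexVertex := s((((![kb, m δ - 1] : Site 2)), (1 : Fin 2)), ((![kb, m δ] : Site 2), (0 : Fin 2)))
    with hekb
  obtain ⟨hFb0, hFbZ⟩ := hnormδ
  have hZbpos : 0 < ‖Z ekb‖ := by rw [← hFbZ]; exact norm_pos_iff.2 hFb0
  ---------------------------------------------------------------- the Green identity at mesh δ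
  have hVR : ∀ v ∈ Λδ, ∑ w' ∈ nbrs v, Literature.Barriers.CriticalPhenomena.HexKernel.term F v w' = 0 :=
    (satisfiesVertexRelations_iff_sum _ _).1 (Dressed.satisfiesVertexRelations_observable hsc habd')
  have hid := greenLimit_identity Λδ F (F ekb) δ φ hVR
  -- the functional: interior part = left side of the identity, plus the boundary part
  have hA : (δ : ℂ) ^ 2 * (∑ v ∈ Λδ.filter (fun v => v.2 = 0), ∑ t ∈ Λδ.filter (fun t => hexGraph.Adj v t),
      dbarAlong 1 φ ((δ : ℂ) * hexMidpoint s(v, t)) * F s(v, t)) / F ekb =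
      ∑ v ∈ Λδ.filter (fun v => v.2 = 0), ∑ t ∈ Λδ.filter (fun t => hexGraph.Adj v t),
        (fderiv ℝ φ ((δ : ℂ) * hexMidpoint s(v, t)) 1 + I * fderiv ℝ φ ((δ : ℂ) * hexMidpoint s(v, t)) I) / 2 *
          ((δ : ℂ) ^ 2 * F s(v, t) / F ekb) := by
    rw [Finset.mul_sum, Finset.sum_div]
    refine Finset.sum_congr rfl fun v _ => ?_
    rw [Finset.mul_sum, Finset.sum_div]
    refine Finset.sum_congr rfl fun t _ => ?_
    rw [dbarAlong_one_eq_div]; ring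
  rw [finsum_midEdges_split Λδ, mul_add, add_div, hA, hid]
  ---------------------------------------------------------------- the four bounds
  -- (a) the boundary term
  have hβ1' : ∀ z ∈ ball c (ρφ + δ / 2), 1 ≤ β z := fun z hz =>
    (hβ1 z (ball_subset_closedBall (ball_subset_ball (by linarith) hz))).symm.le
  have hρδ : ρ / 4 + 2 * δ ≤ ρ := by linarith
  have hρφδ : ρφ + δ ≤ ρ / 4 := by rw [hηdef] at hδη; linarith
  have hbd := boundary_term_at hsc huw hu hw hδ hρδ hpin hafarδ hbnearδ (NNReal.coe_nonneg Kφ) hφL hφsupp hρφδ hβ0 hβ1'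
  -- the bump bound
  have hWf : {e : Sym2 HexVertex | e ∈ hexDomainBoundary Λδ ∧ (δ : ℂ) * hexMidpoint e ∈ ball c (ρ / 4)}.Finite :=
    GateMass.finite_boundaryWindow Λδ _
  have hbump : δ * (∑ᶠ e ∈ {e : Sym2 HexVertex | e ∈ hexDomainBoundary Λδ ∧ (δ : ℂ) * hexMidpoint e ∈ ball c (ρ / 4)},
      β ((δ : ℂ) * hexMidpoint e) * ‖Z e‖) / ‖Z ekb‖ ≤ ‖ℓ‖ + 1 := by
    rw [← norm_bumpSum_eq Λδ s(u, w) ekb hδ.le hβ0 _ hWf]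
    exact hbddδ.le
  have hRnn : 0 ≤ δ * (∑ᶠ e ∈ {e : Sym2 HexVertex | e ∈ hexDomainBoundary Λδ ∧ (δ : ℂ) * hexMidpoint e ∈ ball c (ρ / 4)},
      β ((δ : ℂ) * hexMidpoint e) * ‖Z e‖) / ‖Z ekb‖ :=
    div_nonneg (mul_nonneg hδ.le (finsum_nonneg fun e => finsum_nonneg fun _ =>
      mul_nonneg (hβ0 _) (norm_nonneg _))) (norm_nonneg _)
  -- (b) the twisted term
  have hbudget : ∀ k : ℕ, δ * (∑ᶠ v ∈ {v : HexVertex | v ∈ Λδ ∧ (δ : ℂ) * hexCenter v ∈ ball c (ρ / 4) ∧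
      v.1 1 = m δ + k}, starMass Λδ s(u, w) v) ≤ CB' * ((k : ℝ) + 1) ^ (3 / 4 : ℝ) * ‖Z ekb‖ := fun k =>
    (hGBδ k).trans (mul_le_mul_of_nonneg_right (mul_le_mul_of_nonneg_right (le_max_left _ _)
      (Real.rpow_nonneg (by positivity) _)) (norm_nonneg _))
  set K : ℕ := ⌊ρ / δ⌋₊ with hKdef
  have hK : ρ / δ ≤ (K : ℝ) + 1 := (Nat.lt_floor_add_one _).le
  have hKle : (K : ℝ) ≤ ρ / δ := Nat.floor_le (by positivity)
  have hDDδ := hDDall Λδ hsc u w huw hu hw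
  have htw := twisted_norm_le_at (ψ := ψ₂) hδ (by linarith) hpin hfloorδ hDDδ hbudget hFbZ hFb0 hMψ (NNReal.coe_nonneg Kψ) hψL
    hψ₂s (by linarith) hK
  have htw' := htw.trans (twisted_sum_le hδ (by linarith) hKle hs0 hs1 hsθ hCB'0 hMψ0 hA₀0 (NNReal.coe_nonneg Kψ))
  -- (c) the Taylor remainder
  have hrem := greenLimit_remainder_norm_le Λδ F (F ekb) φ hδ hδη.le hM0 hM (r := η / 2)
  have hind := remainder_indicator_le Λδ s(u, w) ekb (m δ) hδ.le hρφ0 (by positivity : (0:ℝ) ≤ η / 2) hφρφ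
    (by rw [hηdef] at hδη ⊢; linarith : δ / 2 + η / 2 + ρφ < ρ / 4)
  have hcake := layerCake_le (a := s(u, w)) hδ hpin hfloorδ hbudget (fun _ => (1 : ℝ)) (fun _ => zero_le_one) hK
  have hgro := delta_sq_mul_sum_growth_le hδ (by linarith) hKle
  have hE : ‖∑ v ∈ Λδ.filter (fun v => v.2 = 0), ∑ t ∈ Λδ.filter (fun t => hexGraph.Adj v t),
      (φ ((δ : ℂ) * hexCenter t) - φ ((δ : ℂ) * hexCenter v) -
          2 * fderiv ℝ φ ((δ : ℂ) * hexMidpoint s(v, t)) ((δ : ℂ) * (hexMidpoint s(v, t) - hexCenter v))) *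
        (hexMidpoint s(v, t) - hexCenter v) * ((δ : ℂ) * F s(v, t) / F ekb)‖ ≤
      M / 8 * (CB' * (2 * ρ) ^ (7 / 4 : ℝ) * δ ^ (1 / 4 : ℝ)) := by
    refine hrem.trans ?_
    rw [mul_assoc (M / 8)]
    refine mul_le_mul_of_nonneg_left ?_ (by positivity)
    simp only [one_mul] at hcake hind
    refine (mul_le_mul_of_nonneg_left hind hδ.le).trans ?_
    rw [hFbZ]
    set Sst : ℝ := ∑ v ∈ Λδ.filter (fun v => (δ : ℂ) * hexCenter v ∈ ball c (ρ / 4)), starMass Λδ s(u, w) v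
      with hSst
    set Sk : ℝ := ∑ k ∈ Finset.range (K + 1), ((k : ℝ) + 1) ^ (3 / 4 : ℝ) with hSk
    have hz : ‖Z ekb‖ ≠ 0 := hZbpos.ne'
    calc δ * (δ ^ 2 / ‖Z ekb‖ * Sst) = δ ^ 2 / ‖Z ekb‖ * (δ * Sst) := by ring
      _ ≤ δ ^ 2 / ‖Z ekb‖ * (CB' * ‖Z ekb‖ * Sk) := mul_le_mul_of_nonneg_left hcake (by positivity)
      _ = (δ ^ 2 / ‖Z ekb‖ * ‖Z ekb‖) * (CB' * Sk) := by ring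
      _ = CB' * (δ ^ 2 * Sk) := by rw [div_mul_cancel₀ _ hz]; ring
      _ ≤ CB' * ((2 * ρ) ^ (7 / 4 : ℝ) * δ ^ (1 / 4 : ℝ)) := mul_le_mul_of_nonneg_left hgro hCB'0
      _ = CB' * (2 * ρ) ^ (7 / 4 : ℝ) * δ ^ (1 / 4 : ℝ) := by ring
  -- (d) the boundary part of the functional
  have hBs := norm_boundary_finsum_le Λδ s(u, w) δ (ψ := dbarAlong 1 φ) (r := ρ / 4) hM₁
    (fun z hz => (hβ1 z (ball_subset_closedBall ((ball_subset_ball (by linarith)) (hφρφ (hψ₁s z hz))))).symm.le)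
    hβ0 hβs
  have hQ : ‖(δ : ℂ) ^ 2 * (∑ᶠ e ∈ hexDomainBoundary Λδ, dbarAlong 1 φ ((δ : ℂ) * hexMidpoint e) * F e) / F ekb‖ ≤
      (M₁ * (‖ℓ‖ + 1)) * δ := by
    rw [norm_div, norm_mul, norm_pow, Complex.norm_real, Real.norm_of_nonneg hδ.le, hFbZ]
    calc δ ^ 2 * ‖∑ᶠ e ∈ hexDomainBoundary Λδ, dbarAlong 1 φ ((δ : ℂ) * hexMidpoint e) * F e‖ / ‖Z ekb‖
        ≤ δ ^ 2 * (M₁ * ∑ᶠ e ∈ {e : Sym2 HexVertex | e ∈ hexDomainBoundary Λδ ∧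
            (δ : ℂ) * hexMidpoint e ∈ ball c (ρ / 4)}, β ((δ : ℂ) * hexMidpoint e) * ‖Z e‖) / ‖Z ekb‖ := by
          gcongr
      _ = M₁ * δ * (δ * (∑ᶠ e ∈ {e : Sym2 HexVertex | e ∈ hexDomainBoundary Λδ ∧
            (δ : ℂ) * hexMidpoint e ∈ ball c (ρ / 4)}, β ((δ : ℂ) * hexMidpoint e) * ‖Z e‖) / ‖Z ekb‖) := by
          ring
      _ ≤ M₁ * δ * (‖ℓ‖ + 1) := mul_le_mul_of_nonneg_left hbump (by positivity)
      _ = (M₁ * (‖ℓ‖ + 1)) * δ := by ring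
  ---------------------------------------------------------------- assemble
  have hP := hbd.trans (mul_le_mul_of_nonneg_left (a := Real.sqrt 3 * ((Kφ : ℝ) * δ / 2)) hbump
    (by positivity))
  rw [show ∀ (P T E Q Xc : ℂ), P - T - 6 * E + Q - Xc = (P - Xc) + (-T) + (-(6 * E)) + Q from
    fun P T E Q Xc => by ring]
  refine (norm_add_le _ _).trans ?_
  refine (add_le_add ((norm_add_le _ _).trans (add_le_add (norm_add_le _ _) le_rfl)) le_rfl).trans ?_
  rw [norm_neg, norm_neg, norm_mul, Complex.norm_ofNat]
  have hsum := add_le_add (add_le_add (add_le_add hP htw') (mul_le_mul_of_nonneg_left hE (by norm_num : (0:ℝ) ≤ 6)))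
    hQ
  refine hsum.trans (le_of_eq ?_)
  simp only [hgA, hgB, hgC, hA₀]
  ring

/-- **Registered stub `stub_gateDbarLimit`** (crux item stmt-CriticalPhenomena-14004, line
`polygon-parity-squeeze`, mechanism (C)): `GateDbarLimit`, the lattice → continuum limit
`N_δ(∂̄φ) → −i√3 ∫ φ e^{(5/8)(L̄ − L_b)} dx` on the gate, from `DefectDecoherence`, the gate profile law
and the gate layer budget. [cite: DuminilCopinSmirnov2012, Conjecture 2 (boundary shadow on the gate)] -/
theorem stub_gateDbarLimit : (∀ (D : DobrushinDomain) (ρ : ℝ) (Λ : ℝ → Finset HexVertex) (m : ℝ → ℤ) (b : ℝ → Sym2 HexVertex), AdmissibleFamily D ρ Λ m b → ∀ (a : ℝ → Sym2 HexVertex) (r₀ : ℝ) (m₀ : ℝ → ℤ), PinnedFlatRoot D Λ b (D.pt 0) a r₀ m₀ → 2 * ρ < dist (D.pt 0) (D.pt 1) → DefectDecoherence → GateProfileAt D ρ (ρ / 4) Λ a b → GateLayerBudgetAt D (ρ / 4) Λ m a b → ∀ (Φ : ConformalEquiv D.carrier UpperHalfPlane.upperHalfPlaneSet) (L : ℂ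 → ℂ) (Lb : ℂ), ConformalFrame D Φ L Lb → ∀ (Lbar : ℂ → ℂ), ContinuousOn Lbar (D.carrier ∪ gateSeg D ρ) → Set.EqOn Lbar L D.carrier → ∀ (φ : ℂ → ℂ), ContDiff ℝ ∞ φ → HasCompactSupport φ → tsupport φ ⊆ Metric.ball (D.pt 1) (ρ / 4) → Filter.Tendsto (fun δ : ℝ => NF Λ a b δ (Literature.Analysis.Complex.dbarAlong 1 φ)) (𝓝[>] 0) (𝓝 (-(Complex.I * (Real.sqrt 3 : ℂ)) * ∫ x in Set.Ioo ((D.pt 1).re - ρ / 4) ((D.pt 1).re + ρ / 4), φ ((x : ℂ) + ((D.pt 1).im : ℂ) * Complex.I) * Complex.exp ((5 / 8 : ℂ) * (Lbar ((x : ℂ) + ((D.pt 1).im : ℂ) * Complex.I) - Lb))))) :=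
  fun _ _ _ _ _ hAF _ _ _ hPR hρd hDD hGP hGB _ _ _ hfr _ hLbar hLbarL _ hφ hφc hφs =>
    gateDbarLimit_of hAF hPR hρd hDD hGP hGB hfr hLbar hLbarL hφ hφc hφs

end Summit.CriticalPhenomena.SAWScalingLimit.Theorems.PolygonParitySqueeze.GateDbar

end
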